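import Summits.BirchSwinnertonDyer.BirchSwinnertonDyer.Theorems.TwoAdicConverseOrdLambdaHalfAtTwoThetaDatumDefs
import Summits.BirchSwinnertonDyer.BirchSwinnertonDyer.Theorems.TwoAdicConverseOrdLambdaHalfAtTwoMeetingExponentDefs
import HarnessLib

/-!
# Route `TwoAdicConverse` (rung S3), crux `OrdLambdaHalfAtTwo` (item stmt-BirchSwinnertonDyer-19556), line `kato_determinant_greenberg_two`:
# the GL(1) ROAD to stub 6‴ through the MEETING EXPONENT `Q` — one theorem, Theorems-side (importable) copy of the skeleton's v4.9 corollary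

Seat `cruxlead-stmt-BirchSwinnertonDyer-19556` g5 (LEAD PROVER, MODE LINE; `--supports` stmt-BirchSwinnertonDyer-19556, helper).  THEOREM ONLY (no definition,
no named fact, no instance, no `sorry`).  HONEST FRAMING (cell `bsd-2adic`): BSD is not proved by any of this; the crux is NOT proved here; the research stub 6‴
`ThetaShapiroGreenbergDivisibilityAtTwo` (⟺ crux∣(β) modulo print, p714345 + skeleton) is NOT proved here — this file states the SUFFICIENT condition through which the
promoted objects O1 `SplitTwoExplicitReciprocityLawBDP` / O2 `BDPSelmerLowerDivisibilityAtTwo` (pen P10 v3) would reach it.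

`thetaGreenbergDivisibility_of_residualCountQ`: on the line's habitat (`K` imaginary quadratic with the Heegner hypothesis for `2N`, `N` odd, `κK` cyclotomic with a
topological generator, `w ∣ 2`, `Σ = {v ∣ N}`, `Φ` the stable line of the rational `2`-torsion point), for every re-keyed Shapiro datum `S` over the Greenberg dual:
6b `ResidualCountEqQAtTwo` (`#R_w^Σ(K_∞,Φ) = 2^{Q(κK,N)}`) ∧ (Glob) ∧ one-place (Loc) ∧ **`2^{gD+corank}·#X^Σ[2]·#(E(K_∞)[2^∞]/2)·2 ≤ 4^{Q(κK,N)}`** ⟹ `gD ≤ λ(X_Gr)`,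
through the `c = 0` lower half of the GL(1) sandwich (`TwoAdicGL1ResidualLineCount.sq_le_two_pow_lambda_mul_of_decomp_surjective`, lead g4 p691349) with its hypothesis
«`w` does not split in `K_∞/K`» (`hsurjw : κK(D_w) = Γ`) DISPLAYED here (it is a theorem — `ZpExtension.IsCyclotomic.exists_mem_decomp_apply_eq_of_split`, lead g5
p711914 — discharged in the sequel `…GL1ResidualCountQRoadSplit`).  SUFFICIENT, not equivalent (window width `2 + t_w`; triage r1-2 (14)(ii)/(15)).

References: [GreenbergVatsal2000] §2 Prop. (2.1), Cor. (2.3), Prop. (2.8); [Ferrero1980AJM]; [Washington1997] §13.1, §13.3; [Matsuno2008] Lemma 4.3.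
-/

set_option linter.dupNamespace false
set_option autoImplicit false

noncomputable section

open scoped Classical NumberField
open WeierstrassCurve NumberField IsDedekindDomain Field CategoryTheory
open Literature.NumberTheory.EllipticCurves Literature.NumberTheory.EllipticCurves.Rank1Residual
open Literature.NumberTheory.EllipticCurves.GreenbergVatsal2000 (datumStrictSelmer unramifiedOutside)
open Literature.NumberTheory.GaloisRepresentations
open Summit.BirchSwinnertonDyer.Rank1Residual.X11b (AcSelmer.bdpData AcSelmer.selmerAc AcSelmer.XAc)
open Summit.BirchSwinnertonDyer.Rank1Residual.X2.ResidualDevissageModules (StableSubgroup)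

namespace Summit.BirchSwinnertonDyer.BirchSwinnertonDyer.Theorems.TwoAdicKatoDeterminant

/-- **Stub 6‴ datum by datum from the MEETING EXPONENT `Q` (pen RC-382 (1); kernel, p691349 §3 + p692237): the GL(1) road at ONE place above `w`.**
On the line's habitat — `K` imaginary quadratic with the Heegner hypothesis for `2N` (`N` odd; in `OrdLambdaHalfAtTwo_of`: `N = N_E`, `K` the Greenberg field),
`κK` CYCLOTOMIC with topological generator, `w ∣ 2` with `κK(D_w) = Γ` («`w` does not split in `K_∞/K`», displayed hypothesis `hsurjw` — a theorem,
`ZpExtension.IsCyclotomic.exists_mem_decomp_apply_eq_of_split`, lead g5 p711914; discharged in `…GL1ResidualCountQRoadSplit`), `Σ = {v ∣ N}`, `Φ` the stable line of the rational `2`-torsion point — for every re-keyed Shapiro datum `S` over the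
Greenberg dual `DGr`: the displayed binder 6b `ResidualCountEqQAtTwo` (`#R_w^Σ(K_∞, Φ) = 2^{Q(κK, N)}`, print-grade `GL(1)`), the two standard surjectivities
(Glob) «every class of `R(E[2]/Φ)` lifts to an `E[2]`-class unramified outside `Σ ∪ {2}`» and the ONE-place (Loc) «every class of `H¹(K_{∞,w}, Φ)` is the
restriction of a class of `H¹(K_∞, Φ)` unramified outside `Σ ∪ {2}`», and the ONE inequality **`2^{gD + corank}·#X^Σ[2]·#(E(K_∞)[2^∞]/2)·2 ≤ 4^{Q(κK, N)}`**
(in `𝔽₂`-dimensions: `gD + corank + τ^Σ + t_∞ + 1 ≤ 2·Q`) imply `gD ≤ λ(X_Gr)` — through the `c = 0` lower half of the GL(1) sandwich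
`#R(Φ)² ≤ 2^{λ+corank}·#X^Σ[2]·#(E(K_∞)[2^∞]/2)·2` (`TwoAdicGL1ResidualLineCount.sq_le_two_pow_lambda_mul_of_decomp_surjective`).  SUFFICIENT, not equivalent:
the sandwich has width `2 + t_w`, and the POSITION of `λ(X_Gr) + corank + τ^Σ + t_∞` in the window `[2Q − 1, 2Q + 1 + t_w]` is pair-by-pair research content
(triage r1-2 (14)(ii)/(15)); this corollary closes 6‴ exactly at the bottom of the window.  `B2`'s residual input (`R_w^Σ(K_∞, Φ)` finite) is READ OFF 6b here.
[cite: GreenbergVatsal2000, §2 Prop. (2.1), Cor. (2.3), Prop. (2.8)] [cite: Ferrero1980AJM, Thm. (λ-formula for imaginary quadratic fields, p = 2)]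
[cite: Washington1997, §13.3 Thm. 13.13] -/
theorem thetaGreenbergDivisibility_of_residualCountQ_of_decomp_surjective {W : WeierstrassCurve ℚ} [W.IsElliptic] [ContinuousSMul ℤ_[2] (W.tateModule 2)]
    {A : WeierstrassCurve ℚ} [A.IsElliptic] [ContinuousSMul ℤ_[2] (A.tateModule 2)]
    {κ : ZpExtension ℚ 2} {γ : absoluteGaloisGroup ℚ} {I_W : Kato2004.IwasawaH1Data W 2 κ γ} {I_A : Kato2004.IwasawaH1Data A 2 κ γ}
    {v : HeightOneSpectrum (𝓞 ℚ)} {γᵥ : absoluteGaloisGroup (v.adicCompletion ℚ)}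
    {J : Kato2004.LocalIwasawaH1Data κ v ((Kato2004.EulerSystemValues.tateRep W 2).toLocal v) γᵥ}
    {J' : Kato2004.LocalIwasawaH1Data κ v (Kato2004.tateLocalOrdinaryRep W 2 v) γᵥ}
    {J_A : Kato2004.LocalIwasawaH1Data κ v ((Kato2004.EulerSystemValues.tateRep A 2).toLocal v) γᵥ}
    {uA : ((Kato2004.EulerSystemValues.tateRep A 2).toLocal v).toTopRep ⟶ ((Kato2004.EulerSystemValues.tateRep W 2).toLocal v).toTopRep}
    {hsurj : Function.Surjective
      (κ.toContinuousMonoidHom.comp (resGalOfEmb (closureEmb (K := ℚ) (v.adicCompletion ℚ))))}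
    {hγ : κ.IsTopGenerator γ} {hγᵥ : κ.IsTopGenerator (resGalOfEmb (closureEmb (K := ℚ) (v.adicCompletion ℚ)) γᵥ)}
    {K : Type} [Field K] [NumberField K] {κK : ZpExtension K 2} {γK : absoluteGaloisGroup K} [Fact (κK.IsTopGenerator γK)]
    {w : HeightOneSpectrum (𝓞 K)}
    {DGr : (W.baseChange K).GreenbergStrictSelmerDualData κK γK (AcSelmer.bdpData (MK W K) 2 w)}
    {Dfi : (W.baseChange K).GreenbergStrictSelmerDualData κK γK (fineData W K)}
    {L₀ L₀' : IwasawaAlgebra 2} {b b' : ℕ}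
    (S : ThetaShapiroKatoGreenbergDatum I_W I_A J J' J_A uA hsurj hγ hγᵥ DGr Dfi L₀ L₀' b b')
    (hK : IsImaginaryQuadratic K) {N : ℕ} (hN : Odd N) (hHeeg : SatisfiesHeegnerHypothesis (2 * N) K)
    (hκK : κK.IsCyclotomic) (hw : ((2 : ℕ) : 𝓞 K) ∈ w.asIdeal)
    (hsurjw : ∀ g : Multiplicative ℤ_[2], ∃ δ ∈ Literature.NumberTheory.EllipticCurves.GreenbergSelmer.decomp w, κK δ = g)
    (hSb : ∀ u : HeightOneSpectrum (𝓞 K), u ∉ {u : HeightOneSpectrum (𝓞 K) | ((N : ℕ) : 𝓞 K) ∈ u.asIdeal} →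
      ((2 : ℕ) : 𝓞 K) ∉ u.asIdeal → (W.baseChange K).HasGoodReductionAt u)
    (Φ : StableSubgroup (absoluteGaloisGroup K) ((W.baseChange K).geomTorsion (2 : ℤ))) (hΦ2 : Nat.card Φ.Sub = 2)
    (h6b : ResidualCountEqQAtTwo)
    (hglob : ∀ z ∈ datumStrictSelmer κK.kerSubgroup Φ.Quot 2 (AcSelmer.bdpData Φ.Quot 2 w)
        {u : HeightOneSpectrum (𝓞 K) | ((N : ℕ) : 𝓞 K) ∈ u.asIdeal},
      ∃ y ∈ unramifiedOutside κK.kerSubgroup (↥((W.baseChange K).geomTorsion (2 : ℤ))) 2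
          {u : HeightOneSpectrum (𝓞 K) | ((N : ℕ) : 𝓞 K) ∈ u.asIdeal},
        Literature.NumberTheory.EllipticCurves.resH1Hom (ContinuousMonoidHom.id κK.kerSubgroup) Φ.proj (fun _ x ↦ Φ.proj_smul _ x) y = z)
    (hloc : ∀ u : Literature.NumberTheory.EllipticCurves.subgroupH1
        (κK.kerSubgroup ⊓ Literature.NumberTheory.EllipticCurves.GreenbergSelmer.decomp w) Φ.Sub,
      ∃ a ∈ unramifiedOutside κK.kerSubgroup Φ.Sub 2 {u : HeightOneSpectrum (𝓞 K) | ((N : ℕ) : 𝓞 K) ∈ u.asIdeal},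
        Literature.NumberTheory.EllipticCurves.resOfLe Φ.Sub
          (inf_le_left : κK.kerSubgroup ⊓ Literature.NumberTheory.EllipticCurves.GreenbergSelmer.decomp w ≤ κK.kerSubgroup) a = u)
    (hineq : 2 ^ (S.gD + zpCorank (↥(AcSelmer.selmerAc (W.baseChange K) 2 κK w {u : HeightOneSpectrum (𝓞 K) | ((N : ℕ) : 𝓞 K) ∈ u.asIdeal}) ⧸
            (AcSelmer.selmerAc (W.baseChange K) 2 κK w ∅).addSubgroupOf
              (AcSelmer.selmerAc (W.baseChange K) 2 κK w {u : HeightOneSpectrum (𝓞 K) | ((N : ℕ) : 𝓞 K) ∈ u.asIdeal})) 2) *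
          Nat.card {x : AcSelmer.XAc (W.baseChange K) 2 κK w {u : HeightOneSpectrum (𝓞 K) | ((N : ℕ) : 𝓞 K) ∈ u.asIdeal} γK // 2 • x = 0} *
          Nat.card (↥(FixedPoints.addSubgroup κK.kerSubgroup (geomPrimaryTorsion (W.baseChange K) 2)) ⧸
            (DistribSMul.toAddMonoidHom (↥(FixedPoints.addSubgroup κK.kerSubgroup (geomPrimaryTorsion (W.baseChange K) 2))) 2).range) * 2 ≤
        4 ^ meetingExponentQ κK N) :
    S.gD ≤ lambdaInvariant 2 DGr.X := by
  haveI : IsTotallyComplex K := hK.isTotallyComplex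
  set Sb : Set (HeightOneSpectrum (𝓞 K)) := {u : HeightOneSpectrum (𝓞 K) | ((N : ℕ) : 𝓞 K) ∈ u.asIdeal} with hSbdef
  -- `Σ = {v ∣ N}` is finite (`N` odd, hence non-zero)
  have hN0 : ((N : ℕ) : 𝓞 K) ≠ 0 := by
    have : (N : ℕ) ≠ 0 := fun h ↦ by simp [h] at hN
    exact_mod_cast this
  have hSbfin : Sb.Finite := by
    refine (Ideal.finite_factors (I := Ideal.span {((N : ℕ) : 𝓞 K)}) ?_).subset fun u hu => ?_
    · rwa [Ne, Ideal.zero_eq_bot, Ideal.span_singleton_eq_bot]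
    · change u.asIdeal ∣ Ideal.span {((N : ℕ) : 𝓞 K)}
      rw [Ideal.dvd_span_singleton]
      exact hu
  -- 6b: `#R_w^Σ(K_∞, Φ) = 2^Q`, in particular `R` is finite (B2's residual input read off 6b)
  have hcard : Nat.card (datumStrictSelmer κK.kerSubgroup Φ.Sub 2 (AcSelmer.bdpData Φ.Sub 2 w) Sb) =
      2 ^ meetingExponentQ κK N := h6b K hK N hN hHeeg κK hκK w hw Φ.Sub hΦ2
  have hRfin : Finite (datumStrictSelmer κK.kerSubgroup Φ.Sub 2 (AcSelmer.bdpData Φ.Sub 2 w) Sb) :=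
    Nat.finite_of_card_ne_zero (by rw [hcard]; positivity)
  have hR : (datumStrictSelmer κK.kerSubgroup Φ.Sub 2 (AcSelmer.bdpData Φ.Sub 2 w) Sb :
      Set (Literature.NumberTheory.EllipticCurves.subgroupH1 κK.kerSubgroup Φ.Sub)).Finite := Set.toFinite _
  -- the `c = 0` lower half of the GL(1) sandwich
  have hlow := Summit.BirchSwinnertonDyer.BirchSwinnertonDyer.Theorems.TwoAdicGL1ResidualLineCount.sq_le_two_pow_lambda_mul_of_decomp_surjective
    (W.baseChange K) κK γK hκK hw hsurjw hSbfin hSb Φ hΦ2 hR DGr hglob hloc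
  rw [hcard, ← pow_mul, show (2 : ℕ) ^ (meetingExponentQ κK N * 2) = 4 ^ meetingExponentQ κK N by
    rw [mul_comm, pow_mul]; norm_num] at hlow
  -- `2^{gD + corank}·t·u·2 ≤ 4^Q ≤ 2^{λ + corank}·t·u·2`
  set cork := zpCorank (↥(AcSelmer.selmerAc (W.baseChange K) 2 κK w Sb) ⧸
    (AcSelmer.selmerAc (W.baseChange K) 2 κK w ∅).addSubgroupOf (AcSelmer.selmerAc (W.baseChange K) 2 κK w Sb)) 2 with hcork
  set t := Nat.card {x : AcSelmer.XAc (W.baseChange K) 2 κK w Sb γK // 2 • x = 0} with ht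
  set u := Nat.card (↥(FixedPoints.addSubgroup κK.kerSubgroup (geomPrimaryTorsion (W.baseChange K) 2)) ⧸
    (DistribSMul.toAddMonoidHom (↥(FixedPoints.addSubgroup κK.kerSubgroup (geomPrimaryTorsion (W.baseChange K) 2))) 2).range) with hu
  have hchain := hineq.trans hlow
  by_cases htu : t * u = 0
  · exfalso
    have h0 : 2 ^ (lambdaInvariant 2 DGr.X + cork) * t * u * 2 = 0 := by
      rcases Nat.mul_eq_zero.mp htu with h0 | h0 <;> simp [h0]
    rw [h0] at hlow
    have : 0 < 4 ^ meetingExponentQ κK N := by positivity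
    omega
  · have htu' : 0 < t * u := Nat.pos_of_ne_zero htu
    have h1 : 2 ^ (S.gD + cork) * (t * u * 2) ≤ 2 ^ (lambdaInvariant 2 DGr.X + cork) * (t * u * 2) := by
      have e1 : 2 ^ (S.gD + cork) * t * u * 2 = 2 ^ (S.gD + cork) * (t * u * 2) := by ring
      have e2 : 2 ^ (lambdaInvariant 2 DGr.X + cork) * t * u * 2 = 2 ^ (lambdaInvariant 2 DGr.X + cork) * (t * u * 2) := by ring
      rw [← e1, ← e2]; exact hchain
    have h2 : 2 ^ (S.gD + cork) ≤ 2 ^ (lambdaInvariant 2 DGr.X + cork) :=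
      Nat.le_of_mul_le_mul_right h1 (by positivity)
    have h3 := (Nat.pow_le_pow_iff_right (by norm_num : 1 < 2)).mp h2
    omega


end Summit.BirchSwinnertonDyer.BirchSwinnertonDyer.Theorems.TwoAdicKatoDeterminant

end
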